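import Mathlib.MeasureTheory.Function.Jacobian
import Mathlib.Geometry.Euclidean.Inversion.Calculus
import Mathlib.Analysis.InnerProductSpace.Projection.FiniteDimensional
import Mathlib.Analysis.SpecialFunctions.Sqrt
import Mathlib.Tactic.Module
import Literature.Analysis.Potential.HyperbolicBallPoisson
import HarnessLib

/-!
# Discharges of `moebius_involutive_ball` (Stoll 2016, Thm 2.1.2 (a)) and of
# `integral_comp_moebius_sphere` (Stoll 2016, Thm 5.3.5, eq. (5.3.1))

Topic `Analysis/Potential`, namespace `Literature.Analysis.Potential.HyperbolicBall`; proofs for the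
definitions/named facts of `Literature.Analysis.Potential.HyperbolicBallPoisson`.

## Part I — `moebius_involutive_ball_holds`

Main result: `moebius_involutive_ball_holds : moebius_involutive_ball` — for `|a| < 1`, Stoll's Möbius
map `φ_a` (2.1.6) sends the open unit ball `𝔹 ⊂ ℝⁿ` into itself and `φ_a(φ_a(x)) = x` on `𝔹`
[Stoll 2016, Thm 2.1.2 (a)], together with the identity (2.1.7)
`1 − |φ_a(x)|² = (1 − |x|²)(1 − |a|²)/ρ(x, a)` (`one_sub_norm_moebius_sq`).

### Proof

Stoll (§2.1, proof of Thm 2.1.2) proves `φ_a ∘ φ_a = id` from Thm 2.1.1 (a Möbius self-map of `𝔹`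
fixing `0` is orthogonal) and the derivatives (2.1.8), and `φ_a(𝔹) ⊆ 𝔹` from (2.1.7). Here both are
obtained by direct algebra, which is shorter in Lean (Mathlib has no Möbius group of `ℝ̂ⁿ`): writing
`φ_a(x) = a + ((1 − |a|²)/ρ(x,a))(|x|²a − x)` (equivalent to (2.1.6) since
`ρ(x,a) = |x − a|² + (1 − |a|²)(1 − |x|²)`), the identities (2.1.7),
`|φ_a(x) − a|² = (1 − |a|²)²|x|²/ρ(x,a)` and `ρ(φ_a(x), a) = (1 − |a|²)²/ρ(x,a)` are rational identities
in `|a|², |x|², ⟨x,a⟩`, and substituting them into (2.1.6) for `φ_a(φ_a(x))` gives `x` coefficientwise.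

## Part II — `integral_comp_moebius_sphere_holds` (Stoll's (5.3.1))

Main result: `integral_comp_moebius_sphere_holds : integral_comp_moebius_sphere` —
`∫_S f(φ_a(t)) dσ(t) = ∫_S P_h(a, t) f(t) dσ(t)` for `n ≥ 2`, `|a| < 1` and every `f`
(`σ` = Mathlib's `volume.toSphere`; proved without the integrability hypothesis, both sides being
`0` together when non-integrable) [Stoll 2016, Thm 5.3.5, eq. (5.3.1), p. 59].

### Proof

Stoll obtains (5.3.1) as the case `ψ = φ_a`, `x = 0` of `P_h[f∘ψ] = P_h[f]∘ψ` (Thm 5.3.5), itself a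
consequence of the `ℋ`-harmonic Dirichlet problem (Thm 5.3.3, Cor 5.3.4, maximum principle) — a
theory not vendored here. We prove (5.3.1) directly for what it is, the change of variables
`t = φ_a(s)` on `S` whose Jacobian is the Poisson kernel (cf. Stoll Ex. 3.5.17, "change of
variables formulas for `S`"):
1. on `S`, `φ_a(t) = a + ((1−|a|²)/|t−a|²)(a − t) = ψ_a(t)` (Stoll (2.1.1):
   `ψ_a = a + (1−|a|²)(a−x)^*`) is the reflection of `t` in the hyperplane `(t − a)^⊥`,
   `φ_a ∘ φ_a = id` on `S`, and `Dψ_a(s) = −((1−|a|²)/|s−a|²)·R_{(s−a)^⊥}` (Mathlib: derivative of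
   the inversion in the sphere `S(a, √(1−|a|²))`);
2. the radial extension `Φ(x) = |x| φ_a(x/|x|)` is an involution of `𝔹 ∖ {0}` with
   `DΦ(x) = R_{(x̂−a)^⊥} ∘ (−λ·id + (1+λ) x̂⊗x̂)`, `λ = (1−|a|²)/|x̂−a|²`, hence
   `|det DΦ(x)| = λ^{n−1} = P_h(a, x̂)` (Stoll (5.1.5));
3. Mathlib's change-of-variables formula (`integral_image_eq_integral_abs_det_fderiv_smul`) on
   `𝔹 ∖ {0}`, polar coordinates (`measurePreserving_homeomorphUnitSphereProd`:
   `∫_{𝔹} F(x/|x|) dx = (1/n) ∫_S F dσ`) and the kernel identity `P_h(a, φ_a t)·P_h(a, t) = 1`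
   (`poissonKernel_moebius_mul`) give (5.3.1).

## References

* M. Stoll, *Harmonic and Subharmonic Function Theory on the Hyperbolic Ball*, LMS Lecture Note
  Ser. 431, Cambridge Univ. Press 2016, doi:10.1017/cbo9781316341063 — §2.1: (2.1.1),
  (2.1.5)–(2.1.7), Thm 2.1.2 (a); §3.3 (polar coordinates (3.3.1)), Ex. 3.5.17; (5.1.5);
  Thm 5.3.5 and eq. (5.3.1) (p. 59). [key `Stoll2016`]
-/

namespace Literature.Analysis.Potential.HyperbolicBall

variable {n : ℕ}

/-- `ρ(x, a) = 1 − 2⟨x, a⟩ + |x|²|a|²` (Stoll's footnote: `ρ(x,a) = [x,a]²`). [cite: Stoll2016, eq. (2.1.5)] -/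
theorem rho_eq_inner (x a : EuclideanSpace ℝ (Fin n)) :
    rho x a = 1 - 2 * inner ℝ x a + ‖x‖ ^ 2 * ‖a‖ ^ 2 := by
  rw [rho, norm_sub_sq_real]
  ring

/-- `ρ(x, a) > 0` for `|a| < 1`, `|x| < 1`. [folklore] -/
theorem rho_pos {x a : EuclideanSpace ℝ (Fin n)} (hx : ‖x‖ < 1) (ha : ‖a‖ < 1) : 0 < rho x a := by
  have ha2 : 0 < 1 - ‖a‖ ^ 2 := by nlinarith [norm_nonneg a]
  have hx2 : 0 < 1 - ‖x‖ ^ 2 := by nlinarith [norm_nonneg x]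
  have h := mul_pos ha2 hx2
  have h' := sq_nonneg ‖x - a‖
  unfold rho
  linarith

/-- Equivalent form of (2.1.6): `φ_a(x) = a + ((1 − |a|²)/ρ(x, a)) (|x|² a − x)` whenever
`ρ(x, a) ≠ 0`. [cite: Stoll2016, eq. (2.1.6)] -/
theorem moebius_eq_add_smul {a x : EuclideanSpace ℝ (Fin n)} (h : rho x a ≠ 0) :
    moebius a x = a + ((1 - ‖a‖ ^ 2) / rho x a) • (‖x‖ ^ 2 • a - x) := by
  have key : ‖x - a‖ ^ 2 = rho x a - (1 - ‖a‖ ^ 2) * (1 - ‖x‖ ^ 2) := by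
    rw [rho]
    ring
  rw [moebius, key]
  match_scalars <;> field_simp
  ring

/-- `‖|x|² a − x‖² = |x|² ρ(x, a)`. [folklore] -/
theorem norm_sq_smul_sub (x a : EuclideanSpace ℝ (Fin n)) :
    ‖‖x‖ ^ 2 • a - x‖ ^ 2 = ‖x‖ ^ 2 * rho x a := by
  rw [norm_sub_sq_real, norm_smul, real_inner_smul_left, rho_eq_inner, real_inner_comm,
    Real.norm_of_nonneg (sq_nonneg _)]
  ring

/-- **Stoll (2.1.7)**: `1 − |φ_a(x)|² = (1 − |x|²)(1 − |a|²)/ρ(x, a)` (whenever `ρ(x,a) ≠ 0`).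
[cite: Stoll2016, eq. (2.1.7)] -/
theorem one_sub_norm_moebius_sq {a x : EuclideanSpace ℝ (Fin n)} (h : rho x a ≠ 0) :
    1 - ‖moebius a x‖ ^ 2 = (1 - ‖x‖ ^ 2) * (1 - ‖a‖ ^ 2) / rho x a := by
  have hP : inner ℝ a x = (1 + ‖x‖ ^ 2 * ‖a‖ ^ 2 - rho x a) / 2 := by
    rw [rho_eq_inner, real_inner_comm]
    ring
  rw [moebius_eq_add_smul h, norm_add_sq_real, norm_smul, mul_pow, Real.norm_eq_abs, sq_abs,
    norm_sq_smul_sub, inner_smul_right, inner_sub_right, inner_smul_right,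
    real_inner_self_eq_norm_sq, hP]
  field_simp
  ring

/-- `|φ_a(x) − a|² = (1 − |a|²)² |x|² / ρ(x, a)` (whenever `ρ(x,a) ≠ 0`). [folklore] -/
theorem norm_moebius_sub_self_sq {a x : EuclideanSpace ℝ (Fin n)} (h : rho x a ≠ 0) :
    ‖moebius a x - a‖ ^ 2 = (1 - ‖a‖ ^ 2) ^ 2 * ‖x‖ ^ 2 / rho x a := by
  rw [moebius_eq_add_smul h, add_sub_cancel_left, norm_smul, mul_pow, Real.norm_eq_abs, sq_abs,
    norm_sq_smul_sub]
  field_simp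

/-- `ρ(φ_a(x), a) = (1 − |a|²)² / ρ(x, a)` (whenever `ρ(x,a) ≠ 0`), i.e.
`[φ_a(x), a] · [x, a] = 1 − |a|²`. [folklore] -/
theorem rho_moebius {a x : EuclideanSpace ℝ (Fin n)} (h : rho x a ≠ 0) :
    rho (moebius a x) a = (1 - ‖a‖ ^ 2) ^ 2 / rho x a := by
  have h1 : ‖moebius a x‖ ^ 2 = 1 - (1 - ‖x‖ ^ 2) * (1 - ‖a‖ ^ 2) / rho x a := by
    linarith [one_sub_norm_moebius_sq h]
  rw [rho, norm_moebius_sub_self_sq h, h1]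
  field_simp
  ring

/-- `φ_a` maps the open unit ball into itself (`|a| < 1`). [cite: Stoll2016, Thm 2.1.2 (a)] -/
theorem norm_moebius_lt_one {a x : EuclideanSpace ℝ (Fin n)} (ha : ‖a‖ < 1) (hx : ‖x‖ < 1) :
    ‖moebius a x‖ < 1 := by
  have hρ := rho_pos hx ha
  have ha2 : 0 < 1 - ‖a‖ ^ 2 := by nlinarith [norm_nonneg a]
  have hx2 : 0 < 1 - ‖x‖ ^ 2 := by nlinarith [norm_nonneg x]
  have h : 0 < 1 - ‖moebius a x‖ ^ 2 := by
    rw [one_sub_norm_moebius_sq hρ.ne']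
    positivity
  nlinarith [norm_nonneg (moebius a x)]

/-- `φ_a(φ_a(x)) = x` on the open unit ball (`|a| < 1`). [cite: Stoll2016, Thm 2.1.2 (a)] -/
theorem moebius_moebius {a x : EuclideanSpace ℝ (Fin n)} (ha : ‖a‖ < 1) (hx : ‖x‖ < 1) :
    moebius a (moebius a x) = x := by
  have hρ := (rho_pos hx ha).ne'
  have ha2 : (1 - ‖a‖ ^ 2) ≠ 0 := by nlinarith [norm_nonneg a]
  have h1 := rho_moebius (a := a) hρ
  have h1' : rho (moebius a x) a ≠ 0 := by
    rw [h1]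
    exact div_ne_zero (pow_ne_zero 2 ha2) hρ
  have h2 : ‖moebius a x‖ ^ 2 = 1 - (1 - ‖x‖ ^ 2) * (1 - ‖a‖ ^ 2) / rho x a := by
    linarith [one_sub_norm_moebius_sq hρ]
  rw [moebius_eq_add_smul h1', h1, h2, moebius_eq_add_smul hρ]
  match_scalars <;> field_simp
  ring

/-- DISCHARGE of the named fact `moebius_involutive_ball` (**Stoll 2016, Thm 2.1.2 (a)** with
eq. (2.1.7)). [cite: Stoll2016, Thm 2.1.2 (a)] -/
theorem moebius_involutive_ball_holds : moebius_involutive_ball :=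
  fun _ _ ha => ⟨fun _ hx => norm_moebius_lt_one ha hx, fun _ hx => moebius_moebius ha hx⟩

end Literature.Analysis.Potential.HyperbolicBall

/-! # Part II — Stoll's (5.3.1): the Möbius change of variables on the sphere -/

noncomputable section

open MeasureTheory Metric Module Set
open scoped RealInnerProductSpace Topology

namespace Literature.Analysis.Potential.HyperbolicBall

variable {n : ℕ} {F : Type*} [NormedAddCommGroup F] [InnerProductSpace ℝ F]

/-! ### II.1 `φ_a` on the unit sphere: involution, and `φ_a(t)` as a reflection of `t` -/

/-- `φ_a` is an involution of the unit sphere: `φ_a(φ_a(t)) = t` for `|t| = 1`, `|a| < 1`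
(the boundary case of Stoll 2016, Thm 2.1.2 (a)). [folklore] -/
theorem moebius_moebius_of_norm_eq_one {a t : EuclideanSpace ℝ (Fin n)} (ha : ‖a‖ < 1)
    (ht : ‖t‖ = 1) : moebius a (moebius a t) = t := by
  have hta : ‖t - a‖ ≠ 0 := by
    intro h
    rw [norm_eq_zero, sub_eq_zero] at h
    rw [h] at ht
    linarith
  have hc : (1 : ℝ) - ‖a‖ ^ 2 ≠ 0 := by nlinarith [norm_nonneg a]
  have hs : ‖moebius a t‖ = 1 := norm_moebius_of_norm_eq_one ha ht
  rw [moebius_of_norm_eq_one ha hs, norm_moebius_sub_self ha ht]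
  conv_lhs => rw [moebius_of_norm_eq_one ha ht]
  rw [sub_add_cancel_left, smul_neg, smul_smul]
  have : (1 - ‖a‖ ^ 2) / ((1 - ‖a‖ ^ 2) / ‖t - a‖) ^ 2 * ((1 - ‖a‖ ^ 2) / ‖t - a‖ ^ 2) = 1 := by
    field_simp
  rw [this, one_smul, neg_sub, add_sub_cancel]

/-- On the unit sphere, `φ_a(t)` is the reflection of `t` in the hyperplane through `0`
orthogonal to `t − a`: `φ_a(t) = R_{(t−a)^⊥} t` for `|t| = 1`, `|a| < 1`. [folklore] -/
theorem moebius_eq_reflection_of_norm_eq_one {a t : EuclideanSpace ℝ (Fin n)} (ha : ‖a‖ < 1)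
    (ht : ‖t‖ = 1) : moebius a t = (ℝ ∙ (t - a))ᗮ.reflection t := by
  have hd : ‖t - a‖ ^ 2 = 1 - 2 * ⟪t, a⟫ + ‖a‖ ^ 2 := by
    rw [norm_sub_sq_real, ht, one_pow]
  have hd0 : (1 : ℝ) - 2 * ⟪t, a⟫ + ‖a‖ ^ 2 ≠ 0 := by
    rw [← hd]
    intro h
    rw [sq_eq_zero_iff, norm_eq_zero, sub_eq_zero] at h
    rw [h] at ht
    linarith
  rw [moebius_of_norm_eq_one ha ht, Submodule.reflection_orthogonal_apply,
    Submodule.reflection_singleton_apply]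
  simp only [RCLike.ofReal_real_eq_id, id_eq]
  rw [inner_sub_left, real_inner_self_eq_norm_sq, real_inner_comm t a, ht, hd]
  match_scalars <;> field_simp <;> ring

/-! ### II.2 Derivatives: the sphere formula `ψ_a`, the norm, the normalisation `x/|x|` -/

/-- Derivative of Stoll's `ψ_a(y) = a + (1 − |a|²)(a − y)^* = a + ((1−|a|²)/|y−a|²)(a − y)`
(Stoll 2016, (2.1.1); `ψ_a = φ_a` on the sphere): `Dψ_a(s) = −((1−|a|²)/|s−a|²) R_{(s−a)^⊥}`,
from Mathlib's derivative of the inversion in the sphere `S(a, √(1−|a|²))`, of which `ψ_a` is the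
point reflection at `a`. [folklore] -/
theorem hasFDerivAt_moebiusSphereFormula {a s : F} (ha : ‖a‖ < 1) (hs : s ≠ a) :
    HasFDerivAt (fun y : F => a + ((1 - ‖a‖ ^ 2) / ‖y - a‖ ^ 2) • (a - y))
      (-((1 - ‖a‖ ^ 2) / ‖s - a‖ ^ 2) • ((ℝ ∙ (s - a))ᗮ.reflection : F →L[ℝ] F)) s := by
  have hc : (0 : ℝ) ≤ 1 - ‖a‖ ^ 2 := by nlinarith [norm_nonneg a]
  have h := (EuclideanGeometry.hasFDerivAt_inversion (c := a) (R := Real.sqrt (1 - ‖a‖ ^ 2))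
    hs).const_sub ((2 : ℝ) • a)
  have hfun : (fun y : F => a + ((1 - ‖a‖ ^ 2) / ‖y - a‖ ^ 2) • (a - y)) =
      fun y => (2 : ℝ) • a - EuclideanGeometry.inversion a (Real.sqrt (1 - ‖a‖ ^ 2)) y := by
    funext y
    simp only [EuclideanGeometry.inversion, dist_eq_norm, vsub_eq_sub, vadd_eq_add, div_pow,
      Real.sq_sqrt hc]
    module
  rw [hfun]
  refine h.congr_fderiv ?_
  rw [dist_eq_norm, div_pow, Real.sq_sqrt hc, neg_smul]

/-- Derivative of the norm of a real inner product space away from `0`: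
`D|·|(x) = ⟨x/|x|, ·⟩`. [folklore] -/
theorem hasFDerivAt_norm_of_ne_zero {x : F} (hx : x ≠ 0) :
    HasFDerivAt (fun y : F => ‖y‖) (innerSL ℝ (‖x‖⁻¹ • x)) x := by
  have hx2 : ‖x‖ ^ 2 ≠ 0 := by positivity
  have h2 := (hasStrictFDerivAt_norm_sq x).hasFDerivAt.sqrt hx2
  have hfun : (fun y : F => ‖y‖) = fun y => Real.sqrt (‖y‖ ^ 2) := by
    funext y
    rw [Real.sqrt_sq (norm_nonneg y)]
  rw [hfun]
  refine h2.congr_fderiv ?_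
  ext1 v
  rw [Real.sqrt_sq (norm_nonneg x)]
  simp
  field_simp

/-- Derivative of the normalisation `y ↦ y/|y|` away from `0`:
`D(y/|y|)(x) v = (v − ⟨x̂, v⟩ x̂)/|x|`, `x̂ = x/|x|`. [folklore] -/
theorem hasFDerivAt_normalize {x : F} (hx : x ≠ 0) :
    HasFDerivAt (fun y : F => ‖y‖⁻¹ • y)
      (‖x‖⁻¹ • (ContinuousLinearMap.id ℝ F -
        (innerSL ℝ (‖x‖⁻¹ • x)).smulRight (‖x‖⁻¹ • x))) x := by
  have hn : HasFDerivAt (fun y : F => ‖y‖⁻¹) ((-(‖x‖ ^ 2)⁻¹) • innerSL ℝ (‖x‖⁻¹ • x)) x :=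
    (hasDerivAt_inv (norm_ne_zero_iff.2 hx)).comp_hasFDerivAt x (hasFDerivAt_norm_of_ne_zero hx)
  have h := hn.smul (hasFDerivAt_id x)
  refine h.congr_fderiv ?_
  ext1 v
  have hx0 : ‖x‖ ≠ 0 := norm_ne_zero_iff.2 hx
  simp
  match_scalars <;> ring

/-! ### II.3 The radial extension `Φ(x) = |x| φ_a(x/|x|)` and its derivative -/

/-- Derivative of the radial extension `Φ(x) = |x| φ_a(x/|x|)` of `φ_a|_S` at `x ≠ 0`:
`DΦ(x) = R_{(x̂−a)^⊥} ∘ (−λ·id + (1+λ) x̂ ⊗ x̂)` with `x̂ = x/|x|`, `λ = (1−|a|²)/|x̂−a|²`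
(a reflection composed with "identity on `ℝx̂`, `−λ` on `x̂^⊥`"). [folklore] -/
theorem hasFDerivAt_radialMoebius {a : EuclideanSpace ℝ (Fin n)} (ha : ‖a‖ < 1)
    {Φ : EuclideanSpace ℝ (Fin n) → EuclideanSpace ℝ (Fin n)}
    (hΦ : ∀ x, Φ x = ‖x‖ • moebius a (‖x‖⁻¹ • x)) {x : EuclideanSpace ℝ (Fin n)} (hx : x ≠ 0) :
    HasFDerivAt Φ
      (((ℝ ∙ (‖x‖⁻¹ • x - a))ᗮ.reflection :
          EuclideanSpace ℝ (Fin n) →L[ℝ] EuclideanSpace ℝ (Fin n)) ∘L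
        (-((1 - ‖a‖ ^ 2) / ‖‖x‖⁻¹ • x - a‖ ^ 2) •
            ContinuousLinearMap.id ℝ (EuclideanSpace ℝ (Fin n)) +
          (1 + (1 - ‖a‖ ^ 2) / ‖‖x‖⁻¹ • x - a‖ ^ 2) •
            (innerSL ℝ (‖x‖⁻¹ • x)).smulRight (‖x‖⁻¹ • x))) x := by
  have hs1 : ‖‖x‖⁻¹ • x‖ = 1 := norm_smul_inv_norm hx
  have hsa : ‖x‖⁻¹ • x ≠ a := fun h => by rw [h] at hs1; linarith
  have hx0 : ‖x‖ ≠ 0 := norm_ne_zero_iff.2 hx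
  have hψ := hasFDerivAt_moebiusSphereFormula ha hsa
  have hN := hasFDerivAt_normalize hx
  have hcomp := HasFDerivAt.comp x (f := fun y : EuclideanSpace ℝ (Fin n) => ‖y‖⁻¹ • y) hψ hN
  have hprod := (hasFDerivAt_norm_of_ne_zero hx).smul hcomp
  have heq : Φ =ᶠ[𝓝 x] (fun y : EuclideanSpace ℝ (Fin n) => ‖y‖) •
      ((fun y : EuclideanSpace ℝ (Fin n) => a + ((1 - ‖a‖ ^ 2) / ‖y - a‖ ^ 2) • (a - y)) ∘
        fun y : EuclideanSpace ℝ (Fin n) => ‖y‖⁻¹ • y) := by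
    filter_upwards [isOpen_compl_singleton.mem_nhds hx] with y hy
    have hy1 : ‖‖y‖⁻¹ • y‖ = 1 := norm_smul_inv_norm hy
    rw [hΦ, Pi.smul_apply', Function.comp_apply, moebius_of_norm_eq_one ha hy1]
  refine (hprod.congr_of_eventuallyEq heq).congr_fderiv ?_
  have hψs : a + ((1 - ‖a‖ ^ 2) / ‖‖x‖⁻¹ • x - a‖ ^ 2) • (a - ‖x‖⁻¹ • x) =
      (ℝ ∙ (‖x‖⁻¹ • x - a))ᗮ.reflection (‖x‖⁻¹ • x) := by
    rw [← moebius_of_norm_eq_one ha hs1, moebius_eq_reflection_of_norm_eq_one ha hs1]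
  set s : EuclideanSpace ℝ (Fin n) := ‖x‖⁻¹ • x with hs_def
  set R : EuclideanSpace ℝ (Fin n) →L[ℝ] EuclideanSpace ℝ (Fin n) :=
    ((ℝ ∙ (s - a))ᗮ.reflection : EuclideanSpace ℝ (Fin n) →L[ℝ] EuclideanSpace ℝ (Fin n))
    with hR_def
  have hRs : (ℝ ∙ (s - a))ᗮ.reflection s = R s := rfl
  rw [hRs] at hψs
  ext1 v
  simp only [Function.comp_apply]
  rw [← hs_def, hψs]
  simp only [add_apply, FunLike.coe_smul, Pi.smul_apply,
    ContinuousLinearMap.comp_apply, ContinuousLinearMap.smulRight_apply,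
    FunLike.coe_sub, Pi.sub_apply, ContinuousLinearMap.id_apply,
    innerSL_apply_apply, map_add, map_sub, map_smul]
  match_scalars <;> field_simp
  ring

/-! ### II.4 The Jacobian determinant: `|det DΦ(x)| = λ^{n−1} = P_h(a, x̂)` -/

/-- For a unit vector `s` of a finite-dimensional real inner product space `F`,
`det(−l·id + (1+l) s ⊗ s) = (−l)^{dim F − 1}` (the map is the identity on `ℝ s` and `−l` on
`s^⊥`). [folklore] -/
theorem det_rankOnePerturbation [FiniteDimensional ℝ F] {s : F} (hs : ‖s‖ = 1) (l : ℝ) :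
    LinearMap.det ((-l • ContinuousLinearMap.id ℝ F + (1 + l) • (innerSL ℝ s).smulRight s :
      F →L[ℝ] F) : F →ₗ[ℝ] F) = (-l) ^ (finrank ℝ F - 1) := by
  have hs0 : s ≠ 0 := by
    intro h
    rw [h, norm_zero] at hs
    exact zero_ne_one hs
  haveI : Nontrivial F := ⟨⟨s, 0, hs0⟩⟩
  set K : Submodule ℝ F := ℝ ∙ s with hK
  set M : F →ₗ[ℝ] F := ((-l • ContinuousLinearMap.id ℝ F + (1 + l) • (innerSL ℝ s).smulRight s :
      F →L[ℝ] F) : F →ₗ[ℝ] F) with hM_def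
  have hM : ∀ v, M v = -l • v + ((1 + l) * ⟪s, v⟫) • s := by
    intro v
    simp only [M, ContinuousLinearMap.coe_coe, add_apply, FunLike.coe_smul, Pi.smul_apply,
      ContinuousLinearMap.id_apply, ContinuousLinearMap.smulRight_apply, innerSL_apply_apply,
      smul_smul]
  let e := K.prodEquivOfIsCompl Kᗮ K.isCompl_orthogonal
  have hconj : (e.symm : F →ₗ[ℝ] K × Kᗮ) ∘ₗ M ∘ₗ (e : K × Kᗮ →ₗ[ℝ] F) =
      LinearMap.prodMap LinearMap.id (-l • LinearMap.id) := by
    apply LinearMap.ext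
    rintro ⟨k, w⟩
    simp only [LinearMap.comp_apply, LinearEquiv.coe_coe, LinearMap.prodMap_apply,
      LinearMap.id_apply, LinearMap.smul_apply]
    rw [LinearEquiv.symm_apply_eq]
    simp only [e, Submodule.coe_prodEquivOfIsCompl', hM, Submodule.coe_smul]
    obtain ⟨μ, hμ⟩ := Submodule.mem_span_singleton.1 k.2
    have hw : ⟪s, (w : F)⟫ = 0 := Submodule.mem_orthogonal_singleton_iff_inner_right.1 w.2
    rw [← hμ, inner_add_right, hw, real_inner_smul_right, real_inner_self_eq_norm_sq, hs]
    module
  have hfin : finrank ℝ Kᗮ = finrank ℝ F - 1 := by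
    apply Submodule.finrank_add_finrank_orthogonal'
    rw [finrank_span_singleton hs0]
    have : 0 < finrank ℝ F := finrank_pos
    omega
  calc LinearMap.det M
      = LinearMap.det ((e.symm : F →ₗ[ℝ] K × Kᗮ) ∘ₗ M ∘ₗ (e.symm.symm : K × Kᗮ →ₗ[ℝ] F)) :=
        (LinearMap.det_conj M e.symm).symm
    _ = LinearMap.det (LinearMap.prodMap (LinearMap.id : K →ₗ[ℝ] K)
          (-l • (LinearMap.id : Kᗮ →ₗ[ℝ] Kᗮ))) := by
        rw [LinearEquiv.symm_symm, hconj]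
    _ = (-l) ^ (finrank ℝ F - 1) := by
        rw [LinearMap.det_prodMap, LinearMap.det_id, LinearMap.det_smul, LinearMap.det_id, hfin]
        ring

/-- Composing with a hyperplane reflection does not change `|det|`. [folklore] -/
theorem abs_det_reflection_comp [FiniteDimensional ℝ F] (u : F) (M : F →L[ℝ] F) :
    |(((ℝ ∙ u)ᗮ.reflection : F →L[ℝ] F) ∘L M).det| = |M.det| := by
  rw [ContinuousLinearMap.det, ContinuousLinearMap.det, ContinuousLinearMap.toLinearMap_comp,
    LinearMap.det_comp, abs_mul]
  have : LinearMap.det (((ℝ ∙ u)ᗮ.reflection : F →L[ℝ] F) : F →ₗ[ℝ] F) =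
      (-1) ^ finrank ℝ (ℝ ∙ u)ᗮᗮ := (ℝ ∙ u)ᗮ.det_reflection
  rw [this, abs_pow, abs_neg, abs_one, one_pow, one_mul]

/-! ### II.5 Polar coordinates for `0`-homogeneous integrands -/

/-- Polar coordinates for a `0`-homogeneous integrand on the unit ball of `ℝⁿ`, `n ≥ 1`:
`∫_{|x|<1} F(x/|x|) dx = (1/n) ∫_S F dσ` (`σ` = Mathlib's `volume.toSphere`, for which
`σ(A) = n · vol((0,1)·A)`; cf. Stoll (3.3.1) for the normalised measures). [folklore] -/
theorem integral_ball_comp_normalize (hn : 1 ≤ n) (F : EuclideanSpace ℝ (Fin n) → ℝ) :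
    ∫ x in ball (0 : EuclideanSpace ℝ (Fin n)) 1, F (‖x‖⁻¹ • x) =
      (n : ℝ)⁻¹ * ∫ t : sphere (0 : EuclideanSpace ℝ (Fin n)) 1, F t
        ∂(volume : Measure (EuclideanSpace ℝ (Fin n))).toSphere := by
  haveI : Nontrivial (EuclideanSpace ℝ (Fin n)) :=
    Module.nontrivial_of_finrank_pos (R := ℝ) (by rw [finrank_euclideanSpace_fin]; exact hn)
  have h1 : ∫ x in ball (0 : EuclideanSpace ℝ (Fin n)) 1, F (‖x‖⁻¹ • x) =
      ∫ x : EuclideanSpace ℝ (Fin n),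
        (ball (0 : EuclideanSpace ℝ (Fin n)) 1).indicator (fun x => F (‖x‖⁻¹ • x)) x :=
    (integral_indicator measurableSet_ball).symm
  have h2 : ∫ x : EuclideanSpace ℝ (Fin n),
        (ball (0 : EuclideanSpace ℝ (Fin n)) 1).indicator (fun x => F (‖x‖⁻¹ • x)) x =
      ∫ x : ({(0 : EuclideanSpace ℝ (Fin n))}ᶜ : Set (EuclideanSpace ℝ (Fin n))),
        (ball (0 : EuclideanSpace ℝ (Fin n)) 1).indicator (fun x => F (‖x‖⁻¹ • x)) x.1
          ∂(Measure.comap Subtype.val volume) := by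
    rw [integral_subtype_comap (measurableSet_singleton _).compl, restrict_compl_singleton]
  have h3 := (Measure.measurePreserving_homeomorphUnitSphereProd
    (volume : Measure (EuclideanSpace ℝ (Fin n)))).integral_comp
    (Homeomorph.measurableEmbedding _)
    (fun p : sphere (0 : EuclideanSpace ℝ (Fin n)) 1 × Ioi (0 : ℝ) =>
      F p.1 * (Iio (⟨1, mem_Ioi.2 one_pos⟩ : Ioi (0 : ℝ))).indicator 1 p.2)
  have h4 : ∀ x : ({(0 : EuclideanSpace ℝ (Fin n))}ᶜ : Set (EuclideanSpace ℝ (Fin n))),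
      (ball (0 : EuclideanSpace ℝ (Fin n)) 1).indicator (fun x => F (‖x‖⁻¹ • x)) x.1 =
        F (homeomorphUnitSphereProd (EuclideanSpace ℝ (Fin n)) x).1 *
          (Iio (⟨1, mem_Ioi.2 one_pos⟩ : Ioi (0 : ℝ))).indicator 1
            (homeomorphUnitSphereProd (EuclideanSpace ℝ (Fin n)) x).2 := by
    intro x
    rw [homeomorphUnitSphereProd_apply_fst_coe]
    simp only [indicator, mem_ball_zero_iff, mem_Iio, Pi.one_apply]
    have : (homeomorphUnitSphereProd (EuclideanSpace ℝ (Fin n)) x).2 < ⟨1, mem_Ioi.2 one_pos⟩ ↔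
        ‖x.1‖ < 1 := by
      rw [← Subtype.coe_lt_coe, homeomorphUnitSphereProd_apply_snd_coe]
    split_ifs with hx1 hx2 hx2 <;> simp_all
  have h5 : ∫ r : Ioi (0 : ℝ), (Iio (⟨1, mem_Ioi.2 one_pos⟩ : Ioi (0 : ℝ))).indicator 1 r
      ∂(Measure.volumeIoiPow (n - 1)) = (n : ℝ)⁻¹ := by
    rw [integral_indicator_one measurableSet_Iio, measureReal_def,
      Measure.volumeIoiPow_apply_Iio, ENNReal.toReal_ofReal (by positivity)]
    have : ((n - 1 : ℕ) : ℝ) + 1 = n := by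
      rw [Nat.cast_sub hn]
      push_cast
      ring
    rw [this, one_pow, one_div]
  rw [h1, h2]
  simp_rw [h4]
  rw [h3, finrank_euclideanSpace_fin,
    integral_prod_mul (μ := (volume : Measure (EuclideanSpace ℝ (Fin n))).toSphere)
      (ν := Measure.volumeIoiPow (n - 1)) (fun t : sphere (0 : EuclideanSpace ℝ (Fin n)) 1 => F t)
      (fun r : Ioi (0 : ℝ) => (Iio (⟨1, mem_Ioi.2 one_pos⟩ : Ioi (0 : ℝ))).indicator 1 r),
    h5, mul_comm]

/-! ### II.6 Stoll's (5.3.1) -/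

/-- The change of variables `t = φ_a(s)` on the unit sphere of `ℝⁿ`, `n ≥ 2`, `|a| < 1`:
`∫_S f(φ_a t) dσ(t) = ∫_S P_h(a,t) f(t) dσ(t)` for every `f` (no integrability needed: both
sides vanish together when non-integrable); Stoll's (5.3.1).
[cite: Stoll2016, Thm 5.3.5 eq. (5.3.1)] -/
theorem integral_comp_moebius_sphere_of_two_le (hn : 2 ≤ n) {a : EuclideanSpace ℝ (Fin n)}
    (ha : ‖a‖ < 1) (f : EuclideanSpace ℝ (Fin n) → ℝ) :
    ∫ t : sphere (0 : EuclideanSpace ℝ (Fin n)) 1, f (moebius a t)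
        ∂(volume : Measure (EuclideanSpace ℝ (Fin n))).toSphere =
      ∫ t : sphere (0 : EuclideanSpace ℝ (Fin n)) 1, poissonKernel n a t * f t
        ∂(volume : Measure (EuclideanSpace ℝ (Fin n))).toSphere := by
  have hn1 : 1 ≤ n := by omega
  haveI : Nontrivial (EuclideanSpace ℝ (Fin n)) :=
    Module.nontrivial_of_finrank_pos (R := ℝ) (by rw [finrank_euclideanSpace_fin]; exact hn1)
  have hc0 : (0 : ℝ) ≤ 1 - ‖a‖ ^ 2 := by nlinarith [norm_nonneg a]
  -- the radial extension of `φ_a|_S`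
  set Φ : EuclideanSpace ℝ (Fin n) → EuclideanSpace ℝ (Fin n) :=
    fun x => ‖x‖ • moebius a (‖x‖⁻¹ • x) with hΦ_def
  have hΦ : ∀ x, Φ x = ‖x‖ • moebius a (‖x‖⁻¹ • x) := fun x => rfl
  have hhat : ∀ x : EuclideanSpace ℝ (Fin n), x ≠ 0 → ‖‖x‖⁻¹ • x‖ = 1 :=
    fun x hx => norm_smul_inv_norm hx
  have hnormΦ : ∀ x : EuclideanSpace ℝ (Fin n), x ≠ 0 → ‖Φ x‖ = ‖x‖ := by
    intro x hx
    rw [hΦ, norm_smul, norm_norm, norm_moebius_of_norm_eq_one ha (hhat x hx), mul_one]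
  have hΦne : ∀ x : EuclideanSpace ℝ (Fin n), x ≠ 0 → Φ x ≠ 0 := by
    intro x hx h
    have := hnormΦ x hx
    rw [h, norm_zero] at this
    exact hx (norm_eq_zero.1 this.symm)
  have hΦhat : ∀ x : EuclideanSpace ℝ (Fin n), x ≠ 0 →
      ‖Φ x‖⁻¹ • Φ x = moebius a (‖x‖⁻¹ • x) := by
    intro x hx
    rw [hnormΦ x hx, hΦ, smul_smul, inv_mul_cancel₀ (norm_ne_zero_iff.2 hx), one_smul]
  have hΦΦ : ∀ x : EuclideanSpace ℝ (Fin n), x ≠ 0 → Φ (Φ x) = x := by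
    intro x hx
    rw [hΦ (Φ x), hΦhat x hx, hnormΦ x hx, moebius_moebius_of_norm_eq_one ha (hhat x hx),
      smul_smul, mul_inv_cancel₀ (norm_ne_zero_iff.2 hx), one_smul]
  -- the punctured ball, mapped onto itself by `Φ`
  set s : Set (EuclideanSpace ℝ (Fin n)) := ball 0 1 \ {0} with hs_def
  have hs_meas : MeasurableSet s := measurableSet_ball.diff (measurableSet_singleton 0)
  have hmaps : MapsTo Φ s s := by
    intro x hx
    refine ⟨?_, hΦne x hx.2⟩
    rw [mem_ball_zero_iff, hnormΦ x hx.2]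
    exact mem_ball_zero_iff.1 hx.1
  have hinj : InjOn Φ s := by
    intro x hx y hy hxy
    have := congr_arg Φ hxy
    rwa [hΦΦ x hx.2, hΦΦ y hy.2] at this
  have himage : Φ '' s = s :=
    Subset.antisymm hmaps.image_subset fun y hy => ⟨Φ y, hmaps hy, hΦΦ y hy.2⟩
  -- the derivative of `Φ` and its Jacobian determinant
  set Φ' : EuclideanSpace ℝ (Fin n) → EuclideanSpace ℝ (Fin n) →L[ℝ] EuclideanSpace ℝ (Fin n) :=
    fun x => ((ℝ ∙ (‖x‖⁻¹ • x - a))ᗮ.reflection :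
        EuclideanSpace ℝ (Fin n) →L[ℝ] EuclideanSpace ℝ (Fin n)) ∘L
      (-((1 - ‖a‖ ^ 2) / ‖‖x‖⁻¹ • x - a‖ ^ 2) •
          ContinuousLinearMap.id ℝ (EuclideanSpace ℝ (Fin n)) +
        (1 + (1 - ‖a‖ ^ 2) / ‖‖x‖⁻¹ • x - a‖ ^ 2) •
          (innerSL ℝ (‖x‖⁻¹ • x)).smulRight (‖x‖⁻¹ • x)) with hΦ'_def
  have hderiv : ∀ x ∈ s, HasFDerivWithinAt Φ (Φ' x) s x := fun x hx =>
    (hasFDerivAt_radialMoebius ha hΦ hx.2).hasFDerivWithinAt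
  have hdet : ∀ x : EuclideanSpace ℝ (Fin n), x ≠ 0 →
      |(Φ' x).det| = poissonKernel n a (‖x‖⁻¹ • x) := by
    intro x hx
    rw [hΦ'_def, abs_det_reflection_comp, ContinuousLinearMap.det,
      det_rankOnePerturbation (hhat x hx), finrank_euclideanSpace_fin, abs_pow, abs_neg,
      abs_of_nonneg (div_nonneg hc0 (sq_nonneg _)), poissonKernel]
  -- change of variables on the punctured ball
  have hcv := integral_image_eq_integral_abs_det_fderiv_smul volume hs_meas hderiv hinj
    (fun y => poissonKernel n a (‖y‖⁻¹ • y) * f (‖y‖⁻¹ • y))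
  rw [himage] at hcv
  have hball : s =ᵐ[volume] ball (0 : EuclideanSpace ℝ (Fin n)) 1 :=
    sdiff_null_ae_eq_self (measure_singleton 0)
  have key : ∫ x in ball (0 : EuclideanSpace ℝ (Fin n)) 1, f (moebius a (‖x‖⁻¹ • x)) =
      ∫ x in ball (0 : EuclideanSpace ℝ (Fin n)) 1,
        poissonKernel n a (‖x‖⁻¹ • x) * f (‖x‖⁻¹ • x) := by
    rw [← setIntegral_congr_set hball, ← setIntegral_congr_set hball, hcv]
    refine setIntegral_congr_fun hs_meas fun x hx => ?_
    rw [hdet x hx.2, hΦhat x hx.2, smul_eq_mul, ← mul_assoc, mul_comm (poissonKernel n a _),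
      poissonKernel_moebius_mul ha (hhat x hx.2), one_mul]
  -- polar coordinates on both sides
  have hL := integral_ball_comp_normalize hn1 (fun y => f (moebius a y))
  have hR := integral_ball_comp_normalize hn1 (fun y => poissonKernel n a y * f y)
  rw [hL, hR] at key
  exact mul_left_cancel₀ (inv_ne_zero (Nat.cast_ne_zero.2 (by omega))) key

/-- **Stoll 2016, Thm 5.3.5, eq. (5.3.1)** (`∫_S f∘φ_a dσ = ∫_S P_h(a,·) f dσ`), DISCHARGE of the
named fact `integral_comp_moebius_sphere`. Stoll derives (5.3.1) from the `ℋ`-harmonic Dirichlet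
problem (Thm 5.3.3, Cor 5.3.4); here it is the change of variables `t = φ_a(s)` on the sphere:
the radial extension `Φ(x) = |x| φ_a(x/|x|)` is an involution of `𝔹 ∖ {0}` with
`|det DΦ(x)| = ((1−|a|²)/|x̂−a|²)^{n−1} = P_h(a, x̂)` (Stoll (5.1.5)); Mathlib's change-of-variables
formula on `𝔹 ∖ {0}` and polar coordinates transport this to `σ`, and the kernel identity
`P_h(a, φ_a t) P_h(a, t) = 1` finishes. [cite: Stoll2016, Thm 5.3.5 eq. (5.3.1)] -/
theorem integral_comp_moebius_sphere_holds : integral_comp_moebius_sphere :=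
  fun _ hn _ ha f _ => integral_comp_moebius_sphere_of_two_le hn ha f

end Literature.Analysis.Potential.HyperbolicBall
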